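import Summits.NavierStokesRegularity.FunctionalMining.PressureMomentRateRpow
import Literature.Analysis.FunctionSpaces.TorusEnstrophyOrthogonality
import HarnessLib

/-!
# FunctionalMining — the deviatoric pressure-Hessian moment `∫|Π^dev|²` and its exact rate

Search for candidate a priori estimates; no regularity claim. Cell `pub-nsfunc`, prove seat
(gen 10). K0 family `EP.Pidev.q` (moments of the deviator `Π^dev = ∇²π − (Δπ/n)I` of the pressure
Hessian, `n = dim`; row `EP.Pidev.q=2`): the functional
`torusPidevMoment q v := ∫ (∑ᵢⱼ (Π^dev_v)ᵢⱼ²)^{q/2}` and, at `q = 2`, the static identity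

`∫|Π^dev_v|² = (1 − 1/n) (∫σ_v² − (∫σ_v)²)`, `σ_v = −s_v = −∑ᵢⱼ∂ᵢvⱼ∂ⱼvᵢ`

(two integrations by parts `∑ᵢⱼ∫(∂ᵢ∂ⱼπ)² = ∫(Δπ)²`, trace bookkeeping, `Δπ_v = σ_v − ∫σ_v`), whence
along every classical unforced solution `d/dt ∫|Π^dev|² = N + νV` with the viscous rate
`V(v) = 2(1 − 1/n)(∫σ_v A_v − (∫σ_v)(∫A_v))` (`∂ₜσ = νA + B`, `PressureMomentRateRpow`). Packaged as
`HasInitialRate (torusPidevMoment 2) N V` for the heat sieve. Identities along smooth solutions only.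
-/

noncomputable section

open MeasureTheory Finset Set Filter Topology
open scoped InnerProductSpace RealInnerProductSpace ContDiff

namespace Summit.NavierStokesRegularity.FunctionalMining

open Literature.Analysis.FunctionSpaces Literature.Analysis.FluidPDE

variable {d : Type*} [Fintype d] [DecidableEq d]

/-! ## 1. Definitions -/

/-- The deviatoric pressure Hessian `(Π^dev_v)ᵢⱼ = ∂ᵢ∂ⱼπ_v − δᵢⱼ (∑ₖ∂ₖ∂ₖπ_v)/n`, `n = #d`.
[ours; bookkeeping] -/
def pidev (v : UnitAddTorus d → EuclideanSpace ℝ d) (i j : d) (x : UnitAddTorus d) : ℝ :=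
  Torus.partialDeriv i (Torus.partialDeriv j (pressureOf v)) x -
    (if i = j then (1 : ℝ) else 0) *
      ((∑ k, Torus.partialDeriv k (Torus.partialDeriv k (pressureOf v)) x) / (Fintype.card d : ℝ))

/-- **K0 family `EP.Pidev.q`: `∫_{T^d} |Π^dev_v|^q`**, `|Π^dev|² = ∑ᵢⱼ (Π^dev)ᵢⱼ²` (real power `q/2`
of the Frobenius square). Search for candidate a priori estimates; no regularity claim.
[ours; packaging] -/
def torusPidevMoment (q : ℝ) (v : UnitAddTorus d → EuclideanSpace ℝ d) : ℝ :=
  ∫ x, (∑ i, ∑ j, pidev v i j x ^ 2) ^ (q / 2)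

/-- **Viscous rate of `∫|Π^dev|²`**: `V(v) = 2(1 − 1/n)(∫σ_vA_v − (∫σ_v)(∫A_v))`, `σ_v = −s_v`.
[ours; bookkeeping] -/
def pidevSqViscousRate (v : UnitAddTorus d → EuclideanSpace ℝ d) : ℝ :=
  2 * (1 - 1 / (Fintype.card d : ℝ)) *
    ((∫ x, -gradSqTrace v x * pressureSqViscousSource v x) -
      (∫ x, -gradSqTrace v x) * ∫ x, pressureSqViscousSource v x)

/-- **Inertial rate of `∫|Π^dev|²`**: `N(v) = 2(1 − 1/n)(∫σ_vB_v − (∫σ_v)(∫B_v))`. [ours; bookkeeping] -/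
def pidevSqInertialRate (v : UnitAddTorus d → EuclideanSpace ℝ d) : ℝ :=
  2 * (1 - 1 / (Fintype.card d : ℝ)) *
    ((∫ x, -gradSqTrace v x * pressureSqInertialSource v x) -
      (∫ x, -gradSqTrace v x) * ∫ x, pressureSqInertialSource v x)

/-! ## 2. The static identity `∫|Π^dev|² = (1 − 1/n)(∫σ² − (∫σ)²)` -/

/-- **`∑ᵢⱼ ∫ (∂ᵢ∂ⱼθ)² = ∫ (∑ₖ∂ₖ∂ₖθ)²`** on the torus (two integrations by parts and the symmetry of
mixed partials). [folklore] -/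
theorem sum_integral_hessian_sq {θ : UnitAddTorus d → ℝ} (hθ : Torus.IsSmooth θ) :
    ∑ i, ∑ j, ∫ x, Torus.partialDeriv i (Torus.partialDeriv j θ) x *
        Torus.partialDeriv i (Torus.partialDeriv j θ) x =
      ∫ x, (∑ k, Torus.partialDeriv k (Torus.partialDeriv k θ) x) *
        ∑ k, Torus.partialDeriv k (Torus.partialDeriv k θ) x := by
  have hij : ∀ i j, ∫ x, Torus.partialDeriv i (Torus.partialDeriv j θ) x *
      Torus.partialDeriv i (Torus.partialDeriv j θ) x =
      ∫ x, Torus.partialDeriv j (Torus.partialDeriv j θ) x *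
        Torus.partialDeriv i (Torus.partialDeriv i θ) x := by
    intro i j
    -- `∫ ∂ᵢ(∂ⱼθ)·∂ᵢ∂ⱼθ = −∫ ∂ⱼθ · ∂ᵢ∂ᵢ∂ⱼθ = −∫ ∂ⱼθ · ∂ⱼ(∂ᵢ∂ᵢθ) = ∫ ∂ⱼ∂ⱼθ · ∂ᵢ∂ᵢθ`
    rw [Torus.integral_partialDeriv_mul_eq_neg_integral (hθ.partialDeriv j)
      ((hθ.partialDeriv j).partialDeriv i) i]
    have hcomm : Torus.partialDeriv i (Torus.partialDeriv i (Torus.partialDeriv j θ)) =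
        Torus.partialDeriv j (Torus.partialDeriv i (Torus.partialDeriv i θ)) := by
      have h1 : Torus.partialDeriv i (Torus.partialDeriv j θ) = Torus.partialDeriv j (Torus.partialDeriv i θ) :=
        funext fun y => Torus.partialDeriv_comm hθ i j y
      rw [h1]
      exact funext fun y => Torus.partialDeriv_comm (hθ.partialDeriv i) i j y
    rw [hcomm, ← Torus.integral_partialDeriv_mul_eq_neg_integral (hθ.partialDeriv j)
      ((hθ.partialDeriv i).partialDeriv i) j]
  have hint : ∀ i j, Integrable (fun x => Torus.partialDeriv j (Torus.partialDeriv j θ) x *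
      Torus.partialDeriv i (Torus.partialDeriv i θ) x) := fun i j =>
    (((hθ.partialDeriv j).partialDeriv j).continuous.mul
      ((hθ.partialDeriv i).partialDeriv i).continuous).integrable_unitAddTorus
  calc ∑ i, ∑ j, ∫ x, Torus.partialDeriv i (Torus.partialDeriv j θ) x *
        Torus.partialDeriv i (Torus.partialDeriv j θ) x
      = ∑ i, ∑ j, ∫ x, Torus.partialDeriv j (Torus.partialDeriv j θ) x *
          Torus.partialDeriv i (Torus.partialDeriv i θ) x :=
        Finset.sum_congr rfl fun i _ => Finset.sum_congr rfl fun j _ => hij i j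
    _ = ∑ i, ∫ x, ∑ j, Torus.partialDeriv j (Torus.partialDeriv j θ) x *
          Torus.partialDeriv i (Torus.partialDeriv i θ) x :=
        Finset.sum_congr rfl fun i _ => (integral_finsetSum _ fun j _ => hint i j).symm
    _ = ∫ x, ∑ i, ∑ j, Torus.partialDeriv j (Torus.partialDeriv j θ) x *
          Torus.partialDeriv i (Torus.partialDeriv i θ) x :=
        (integral_finsetSum _ fun i _ => integrable_finsetSum _ fun j _ => hint i j).symm
    _ = _ := integral_congr_ae (ae_of_all _ fun x => by rw [Finset.sum_mul_sum]; exact Finset.sum_comm)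

/-- Pointwise: `∑ᵢⱼ (Π^dev)ᵢⱼ² = ∑ᵢⱼ(∂ᵢ∂ⱼπ)² − (∑ₖ∂ₖ∂ₖπ)²/n`. [folklore] -/
theorem sum_pidev_sq [Nonempty d] (v : UnitAddTorus d → EuclideanSpace ℝ d) (x : UnitAddTorus d) :
    ∑ i, ∑ j, pidev v i j x ^ 2 =
      (∑ i, ∑ j, Torus.partialDeriv i (Torus.partialDeriv j (pressureOf v)) x *
        Torus.partialDeriv i (Torus.partialDeriv j (pressureOf v)) x) -
      (∑ k, Torus.partialDeriv k (Torus.partialDeriv k (pressureOf v)) x) ^ 2 / (Fintype.card d : ℝ) := by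
  have hn : (0 : ℝ) < (Fintype.card d : ℝ) := by exact_mod_cast Fintype.card_pos
  set L := ∑ k, Torus.partialDeriv k (Torus.partialDeriv k (pressureOf v)) x with hL
  set H : d → d → ℝ := fun i j => Torus.partialDeriv i (Torus.partialDeriv j (pressureOf v)) x with hH
  have e : ∀ i j, pidev v i j x ^ 2 =
      H i j * H i j - 2 * ((if i = j then (1 : ℝ) else 0) * H i j) * (L / Fintype.card d) +
        (if i = j then (1 : ℝ) else 0) * (L / Fintype.card d) ^ 2 := by
    intro i j
    simp only [pidev, hH, hL]
    split_ifs <;> ring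
  simp_rw [e, Finset.sum_add_distrib, Finset.sum_sub_distrib, ← Finset.sum_mul, ← Finset.mul_sum]
  have hdiag : ∑ i, ∑ j, (if i = j then (1 : ℝ) else 0) * H i j = L := by
    simp only [ite_mul, one_mul, zero_mul, Finset.sum_ite_eq, Finset.mem_univ, if_true]
    rfl
  have hcount : ∑ i : d, ∑ j : d, (if i = j then (1 : ℝ) else 0) = (Fintype.card d : ℝ) := by
    simp [Finset.sum_ite_eq]
  rw [hdiag, hcount]
  field_simp
  ring

/-- **`∫|Π^dev_v|² = (1 − 1/n)(∫σ_v² − (∫σ_v)²)`** for smooth `v`, `σ_v = −s_v`. [ours; elementary] -/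
theorem torusPidevMoment_two [Nonempty d] {v : UnitAddTorus d → EuclideanSpace ℝ d} (hv : Torus.IsSmooth v) :
    torusPidevMoment 2 v = (1 - 1 / (Fintype.card d : ℝ)) *
      ((∫ x, -gradSqTrace v x * -gradSqTrace v x) - (∫ x, -gradSqTrace v x) ^ 2) := by
  have hn : (Fintype.card d : ℝ) ≠ 0 := by exact_mod_cast Fintype.card_ne_zero
  have hπ : Torus.IsSmooth (pressureOf v) := isSmooth_pressureOf hv
  have hσ : Torus.IsSmooth (fun x => -gradSqTrace v x) := isSmooth_neg_gradSqTrace hv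
  -- `L = Δπ = σ − ∫σ`
  have hL : ∀ x, ∑ k, Torus.partialDeriv k (Torus.partialDeriv k (pressureOf v)) x =
      -gradSqTrace v x - ∫ y, -gradSqTrace v y := by
    intro x
    rw [← Torus.laplacian_eq_sum_partialDeriv_partialDeriv hπ, pressureOf]
    exact Torus.laplacian_invLaplacian hσ x
  unfold torusPidevMoment
  have e1 : ∀ x, (∑ i, ∑ j, pidev v i j x ^ 2) ^ ((2 : ℝ) / 2) = ∑ i, ∑ j, pidev v i j x ^ 2 := by
    intro x; rw [show (2 : ℝ) / 2 = 1 by norm_num, Real.rpow_one]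
  simp_rw [e1, sum_pidev_sq]
  have hH : ∀ i j, Integrable (fun x => Torus.partialDeriv i (Torus.partialDeriv j (pressureOf v)) x *
      Torus.partialDeriv i (Torus.partialDeriv j (pressureOf v)) x) := fun i j =>
    (((hπ.partialDeriv j).partialDeriv i).continuous.mul
      ((hπ.partialDeriv j).partialDeriv i).continuous).integrable_unitAddTorus
  have hLc : Continuous fun x => ∑ k, Torus.partialDeriv k (Torus.partialDeriv k (pressureOf v)) x :=
    continuous_finsetSum _ fun k _ => ((hπ.partialDeriv k).partialDeriv k).continuous
  have iS : Integrable (fun x => ∑ i, ∑ j, Torus.partialDeriv i (Torus.partialDeriv j (pressureOf v)) x *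
      Torus.partialDeriv i (Torus.partialDeriv j (pressureOf v)) x) :=
    integrable_finsetSum _ fun i _ => integrable_finsetSum _ fun j _ => hH i j
  have iL : Integrable (fun x => (∑ k, Torus.partialDeriv k (Torus.partialDeriv k (pressureOf v)) x) ^ 2 /
      (Fintype.card d : ℝ)) := ((hLc.pow 2).div_const _).integrable_unitAddTorus
  rw [integral_sub iS iL, integral_div, integral_finsetSum _ (fun i _ => integrable_finsetSum _ fun j _ => hH i j)]
  simp_rw [integral_finsetSum _ (fun j _ => hH _ j)]
  rw [sum_integral_hessian_sq hπ]
  simp_rw [hL]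
  -- `∫(σ − m)² = ∫σ² − m²`
  set m := ∫ y, -gradSqTrace v y with hm
  have iσ : Integrable (fun x => -gradSqTrace v x) := hσ.continuous.integrable_unitAddTorus
  have iσ2 : Integrable (fun x => -gradSqTrace v x * -gradSqTrace v x) :=
    (hσ.continuous.mul hσ.continuous).integrable_unitAddTorus
  have e2 : ∀ x, (-gradSqTrace v x - m) * (-gradSqTrace v x - m) =
      -gradSqTrace v x * -gradSqTrace v x - 2 * m * -gradSqTrace v x + m ^ 2 := by intro x; ring
  have e3 : ∀ x, (-gradSqTrace v x - m) ^ 2 = (-gradSqTrace v x - m) * (-gradSqTrace v x - m) := by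
    intro x; ring
  simp_rw [e3, e2]
  have i4 : Integrable (fun x => 2 * m * -gradSqTrace v x) := iσ.const_mul _
  have i5 : Integrable (fun x => -gradSqTrace v x * -gradSqTrace v x - 2 * m * -gradSqTrace v x) := iσ2.sub i4
  have i6 : Integrable (fun _ : UnitAddTorus d => m ^ 2) := integrable_const _
  rw [integral_add i5 i6, integral_sub iσ2 i4, integral_const_mul, integral_const, smul_eq_mul,
    probReal_univ, one_mul, ← hm]
  field_simp
  ring

/-! ## 3. The exact rate -/

/-- **`d/dt ∫|Π^dev|² = N + νV` along classical unforced solutions on `T^d`.** [ours] -/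
theorem hasDerivWithinAt_torusPidevMoment_two [Nonempty d] {a b ν : ℝ}
    {u : ℝ → UnitAddTorus d → EuclideanSpace ℝ d} {p : ℝ → UnitAddTorus d → ℝ}
    (h : Torus.IsClassicalNSSolutionOn (Icc a b) ν 0 u p) (hab : a < b) {t : ℝ} (ht : t ∈ Icc a b) :
    HasDerivWithinAt (fun s => torusPidevMoment 2 (u s))
      (pidevSqInertialRate (u t) + ν * pidevSqViscousRate (u t)) (Icc a b) t := by
  have hU : UniqueDiffOn ℝ (Icc a b) := uniqueDiffOn_Icc hab
  have hu : Torus.IsSmoothSpaceTimeOn (Icc a b) u := h.smooth_velocity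
  have hus : ∀ s ∈ Icc a b, Torus.IsSmooth (u s) := fun s hs => hu.isSmooth_slice hs
  have hut : Torus.IsSmooth (u t) := hus t ht
  have hσ : Torus.IsSmoothSpaceTimeOn (Icc a b) (fun s x => -gradSqTrace (u s) x) := by
    have h1 : Torus.IsSmoothSpaceTimeOn (Icc a b) (fun s x => gradSqTrace (u s) x) :=
      Torus.IsSmoothSpaceTimeOn.sum fun i _ => Torus.IsSmoothSpaceTimeOn.sum fun j _ =>
        ((hu.partialDeriv hU i).apply j).mul ((hu.partialDeriv hU j).apply i)
    exact h1.neg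
  set n : ℝ := (Fintype.card d : ℝ) with hn
  -- `G(s) = (1 − 1/n)(∫σ² − (∫σ)²)` agrees with the functional on the window
  have hD1 := (hσ.mul hσ).hasDerivWithinAt_integral (convex_Icc a b) ht
  have hD2 := hσ.hasDerivWithinAt_integral (convex_Icc a b) ht
  have hD := ((hD1.sub (hD2.pow 2)).const_mul (1 - 1 / n))
  refine (hD.congr_deriv ?_).congr (fun s hs => torusPidevMoment_two (hus s hs)) (torusPidevMoment_two hut)
  -- the slices: `∂ₜσ = νA + B`
  have hAB : ∀ x, Torus.timeDerivWithin (Icc a b) (fun s y => -gradSqTrace (u s) y) t x =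
      ν * pressureSqViscousSource (u t) x + pressureSqInertialSource (u t) x := by
    intro x; rw [timeDerivWithin_neg_gradSqTrace h hab ht]
  have hslice : ∀ x, Torus.timeDerivWithin (Icc a b)
      (fun s y => -gradSqTrace (u s) y * -gradSqTrace (u s) y) t x =
      2 * -gradSqTrace (u t) x * (ν * pressureSqViscousSource (u t) x + pressureSqInertialSource (u t) x) := by
    intro x
    have h1 := hσ.hasDerivWithinAt_slice ht x
    have h2 := h1.fun_mul h1
    rw [Torus.timeDerivWithin, h2.derivWithin (hU t ht), hAB x]
    ring
  simp_rw [hslice, hAB]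
  simp only [Nat.cast_ofNat, Nat.add_one_sub_one, pow_one]
  -- integrate and compare with the definitions
  have hA : Torus.IsSmooth (pressureSqViscousSource (u t)) := isSmooth_pressureSqViscousSource hut
  have hB : Torus.IsSmooth (pressureSqInertialSource (u t)) := isSmooth_pressureSqInertialSource hut
  have hσt : Torus.IsSmooth (fun x => -gradSqTrace (u t) x) := isSmooth_neg_gradSqTrace hut
  have iσA : Integrable (fun x => -gradSqTrace (u t) x * pressureSqViscousSource (u t) x) :=
    (hσt.continuous.mul hA.continuous).integrable_unitAddTorus
  have iσB : Integrable (fun x => -gradSqTrace (u t) x * pressureSqInertialSource (u t) x) :=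
    (hσt.continuous.mul hB.continuous).integrable_unitAddTorus
  have iA : Integrable (pressureSqViscousSource (u t)) := hA.continuous.integrable_unitAddTorus
  have iB : Integrable (pressureSqInertialSource (u t)) := hB.continuous.integrable_unitAddTorus
  have e1 : ∀ x, 2 * -gradSqTrace (u t) x *
      (ν * pressureSqViscousSource (u t) x + pressureSqInertialSource (u t) x) =
      2 * ν * (-gradSqTrace (u t) x * pressureSqViscousSource (u t) x) +
        2 * (-gradSqTrace (u t) x * pressureSqInertialSource (u t) x) := by intro x; ring
  simp_rw [e1]
  have i1 : Integrable (fun x => 2 * ν * (-gradSqTrace (u t) x * pressureSqViscousSource (u t) x)) :=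
    iσA.const_mul _
  have i2 : Integrable (fun x => 2 * (-gradSqTrace (u t) x * pressureSqInertialSource (u t) x)) :=
    iσB.const_mul _
  have i3 : Integrable (fun x => ν * pressureSqViscousSource (u t) x) := iA.const_mul ν
  rw [integral_add i1 i2, integral_const_mul, integral_const_mul, integral_add i3 iB, integral_const_mul,
    pidevSqViscousRate, pidevSqInertialRate, ← hn]
  ring

/-- **The initial rates of the row `EP.Pidev.q=2`**: `HasInitialRate (torusPidevMoment 2) N V` on `T³`.
[ours] -/
theorem hasInitialRate_torusPidevMoment_two :
    HasInitialRate (d := d) (torusPidevMoment 2) pidevSqInertialRate pidevSqViscousRate := by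
  intro hd ν _ a b hab u p hsol _
  haveI : Nonempty d := Fintype.card_pos_iff.mp (by omega)
  exact hasDerivWithinAt_torusPidevMoment_two hsol hab (left_mem_Icc.2 hab.le)

end Summit.NavierStokesRegularity.FunctionalMining
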